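import Summits.Ventures.HodgeRepro2.LevelPositivity

/-!
# The level idempotent `e_K` on smooth vectors (Tier-5 kernel support, seat p8)

Kernel-checked form of the Hecke-dictionary sentence «`e_K • π = π^K`»: for a representation `ρ`
of a group `G` on a `k`-vector space `V` and a subgroup `K`, the averaging operator

  `e_K v := [K : K_v]⁻¹ · Σ_{c ∈ K / K_v} ρ(rep c) v`   (`K_v` = the stabiliser of `v` in `K`)

is meaningful whenever `K_v` has finite index in `K` and that index is invertible in `k` — e.g.
for every vector of a smooth representation and every compact subgroup `K` (`kFinite_of_isSmooth`)
in characteristic `0`.  We prove: the value does not depend on the finite-index subgroup `H ≤ K_v`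
used to compute it (`levelAverage_eq`); `e_K` is `k`-linear (`levelIdempotent`); its image lies in
the `K`-invariants and it is the identity on them (`isProj_levelIdempotent`,
`range_levelIdempotent`); `e_K` absorbs `K` on both sides (`apply_levelAverage`,
`levelAverage_apply`); and for `K' ≤ K` one has `e_K e_{K'} = e_{K'} e_K = e_K`
(`levelAverage_of_le`, `levelAverage_levelAverage_of_le`) — the relations of the directed family
of idempotents of the Hecke algebra, stated without any Haar measure (the normalisation
`[K : K_v]⁻¹` replaces `vol(K_v)/vol(K)`).  No property of any specific group is asserted.
-/

namespace Summit.Ventures.HodgeRepro2.T5LevelIdempotent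

open Summit.Ventures.HodgeRepro2.LevelPositivity

variable {G : Type*} [Group G] {k : Type*} [Field k] {V : Type*} [AddCommGroup V] [Module k V]

section Stabilizer

variable (ρ : Representation k G V)

/-- The stabiliser of `v` inside `K`, as a subgroup of `K`. -/
def stabilizerIn (K : Subgroup G) (v : V) : Subgroup K :=
  (stabilizer ρ v).subgroupOf K

variable {ρ}

/-- Membership in `stabilizerIn`. -/
theorem mem_stabilizerIn_iff {K : Subgroup G} {v : V} {κ : K} :
    κ ∈ stabilizerIn ρ K v ↔ ρ (κ : G) v = v := by
  simp only [stabilizerIn, Subgroup.mem_subgroupOf, mem_stabilizer_iff]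

/-- `K_v = K` exactly when `v` is `K`-invariant. -/
theorem stabilizerIn_eq_top_iff {K : Subgroup G} {v : V} :
    stabilizerIn ρ K v = ⊤ ↔ v ∈ invariants ρ K := by
  rw [eq_top_iff, mem_invariants_iff]
  constructor
  · intro h g hg
    exact mem_stabilizerIn_iff.1 (h (Subgroup.mem_top (⟨g, hg⟩ : K)))
  · intro h κ _
    exact mem_stabilizerIn_iff.2 (h κ κ.2)

/-- The stabiliser of `v` fixes every scalar multiple of `v`. -/
theorem stabilizerIn_le_smul (K : Subgroup G) (c : k) (v : V) :
    stabilizerIn ρ K v ≤ stabilizerIn ρ K (c • v) := by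
  intro κ hκ
  rw [mem_stabilizerIn_iff] at hκ ⊢
  rw [map_smul, hκ]

/-- The common stabiliser of `v` and `w` fixes `v + w`. -/
theorem inf_le_stabilizerIn_add (K : Subgroup G) (v w : V) :
    stabilizerIn ρ K v ⊓ stabilizerIn ρ K w ≤ stabilizerIn ρ K (v + w) := by
  intro κ hκ
  rw [Subgroup.mem_inf, mem_stabilizerIn_iff, mem_stabilizerIn_iff] at hκ
  rw [mem_stabilizerIn_iff, map_add, hκ.1, hκ.2]

/-- The normal core of `K_v` (in `K`) fixes every translate `ρ κ₀ v`, `κ₀ ∈ K`. -/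
theorem normalCore_le_stabilizerIn_apply {K : Subgroup G} (κ₀ : K) (v : V) :
    (stabilizerIn ρ K v).normalCore ≤ stabilizerIn ρ K (ρ (κ₀ : G) v) := by
  intro κ hκ
  have h : κ₀⁻¹ * κ * κ₀ ∈ stabilizerIn ρ K v :=
    Subgroup.normalCore_le _ ((Subgroup.normalCore_normal _).conj_mem' κ hκ κ₀)
  rw [mem_stabilizerIn_iff] at h ⊢
  calc ρ (κ : G) (ρ (κ₀ : G) v) = ρ ((κ * κ₀ : K) : G) v := by
        rw [Subgroup.coe_mul, map_mul, Module.End.mul_apply]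
    _ = ρ ((κ₀ * (κ₀⁻¹ * κ * κ₀) : K) : G) v := by
        congr 2
        group
    _ = ρ (κ₀ : G) (ρ ((κ₀⁻¹ * κ * κ₀ : K) : G) v) := by
        rw [Subgroup.coe_mul, map_mul, Module.End.mul_apply]
    _ = ρ (κ₀ : G) v := by rw [h]

end Stabilizer

section CosetSum

variable (ρ : Representation k G V)

/-- `Σ_{c ∈ K/H} ρ(rep c) v` for the representatives chosen by `Quotient.out`; meaningful when
`H` fixes `v` (then the summand does not depend on the representative, `rep_eq`). -/
noncomputable def cosetSum {K : Subgroup G} (H : Subgroup K) (v : V) : V :=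
  ∑ᶠ c : K ⧸ H, ρ ((Quotient.out c : K) : G) v

variable {ρ}

/-- When `H` fixes `v`, the summand of `cosetSum` depends only on the coset. -/
theorem rep_eq {K : Subgroup G} {H : Subgroup K} {v : V} (hH : H ≤ stabilizerIn ρ K v) (κ : K) :
    ρ ((Quotient.out (κ : K ⧸ H) : K) : G) v = ρ (κ : G) v := by
  obtain ⟨h, hh⟩ := QuotientGroup.mk_out_eq_mul H κ
  rw [hh, Subgroup.coe_mul, map_mul, Module.End.mul_apply, mem_stabilizerIn_iff.1 (hH h.2)]

/-- The tower rule: for `H' ≤ H ≤ K_v` with `[K : H']` finite,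
`cosetSum H' v = [H : H'] • cosetSum H v`. -/
theorem cosetSum_eq_of_le {K : Subgroup G} {H' H : Subgroup K} (hle : H' ≤ H) {v : V}
    (hH : H ≤ stabilizerIn ρ K v) [H'.FiniteIndex] :
    cosetSum ρ H' v = (H'.relIndex H) • cosetSum ρ H v := by
  haveI : H.FiniteIndex := Subgroup.finiteIndex_of_le hle
  letI : Fintype (K ⧸ H') := Fintype.ofFinite _
  letI : Fintype (K ⧸ H) := Fintype.ofFinite _
  letI : Fintype (H ⧸ H'.subgroupOf H) := Fintype.ofFinite _
  have key : ∑ c : K ⧸ H', ρ ((Quotient.out c : K) : G) v =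
      ∑ p : (K ⧸ H) × (H ⧸ H'.subgroupOf H), ρ ((Quotient.out p.1 : K) : G) v := by
    refine Fintype.sum_equiv (Subgroup.quotientEquivProdOfLE hle) _ _ (fun x => ?_)
    obtain ⟨κ, rfl⟩ := QuotientGroup.mk_surjective x
    show ρ ((Quotient.out (κ : K ⧸ H') : K) : G) v = ρ ((Quotient.out (κ : K ⧸ H) : K) : G) v
    rw [rep_eq (hle.trans hH) κ, rep_eq hH κ]
  unfold cosetSum
  rw [finsum_eq_sum_of_fintype, finsum_eq_sum_of_fintype, key, Fintype.sum_prod_type]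
  simp only [Finset.sum_const, Finset.card_univ]
  rw [Finset.smul_sum, Subgroup.relIndex, Subgroup.index_eq_card, Nat.card_eq_fintype_card]

/-- Over the trivial quotient `K ⧸ ⊤` the coset sum of a `K`-invariant vector is the vector. -/
theorem cosetSum_top {K : Subgroup G} {v : V} (hv : v ∈ invariants ρ K) :
    cosetSum ρ (⊤ : Subgroup K) v = v := by
  haveI : Subsingleton (K ⧸ (⊤ : Subgroup K)) := QuotientGroup.subsingleton_quotient_top
  letI : Fintype (K ⧸ (⊤ : Subgroup K)) := Fintype.ofFinite _
  unfold cosetSum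
  rw [finsum_eq_sum_of_fintype, Fintype.sum_subsingleton _ ((1 : K) : K ⧸ (⊤ : Subgroup K))]
  exact mem_invariants_iff.1 hv _ (Quotient.out ((1 : K) : K ⧸ (⊤ : Subgroup K))).2

/-- The coset sum over any `H ≤ K_v` of finite index is `K`-invariant: `ρ κ₀ ∘ (Σ_c ρ(rep c)) = Σ_c ρ(rep c)`
(left translation permutes the cosets). -/
theorem apply_cosetSum {K : Subgroup G} {H : Subgroup K} {v : V} (hH : H ≤ stabilizerIn ρ K v)
    [H.FiniteIndex] (κ₀ : K) : ρ (κ₀ : G) (cosetSum ρ H v) = cosetSum ρ H v := by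
  letI : Fintype (K ⧸ H) := Fintype.ofFinite _
  unfold cosetSum
  rw [finsum_eq_sum_of_fintype, map_sum]
  refine Fintype.sum_equiv (MulAction.toPerm κ₀) _ _ (fun c => ?_)
  obtain ⟨κ, rfl⟩ := QuotientGroup.mk_surjective c
  show ρ (κ₀ : G) (ρ ((Quotient.out (κ : K ⧸ H) : K) : G) v) =
    ρ ((Quotient.out (κ₀ • (κ : K ⧸ H)) : K) : G) v
  rw [MulAction.Quotient.smul_mk, smul_eq_mul, rep_eq hH, rep_eq hH, Subgroup.coe_mul, map_mul,
    Module.End.mul_apply]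

end CosetSum

section Average

variable (ρ : Representation k G V)

/-- The level-`K` average `e_K v = [K : K_v]⁻¹ · Σ_{c ∈ K/K_v} ρ(rep c) v`
(a total function; the lemmas below assume `[K : K_v]` finite and non-zero in `k`). -/
noncomputable def levelAverage (K : Subgroup G) (v : V) : V :=
  ((stabilizerIn ρ K v).index : k)⁻¹ • cosetSum ρ (stabilizerIn ρ K v) v

variable {ρ}

/-- Independence of the level: any finite-index `H ≤ K_v` with `[K : H] ≠ 0` in `k` computes `e_K v`. -/
theorem levelAverage_eq {K : Subgroup G} {H : Subgroup K} {v : V} (hH : H ≤ stabilizerIn ρ K v)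
    [H.FiniteIndex] (hk : (H.index : k) ≠ 0) :
    levelAverage ρ K v = (H.index : k)⁻¹ • cosetSum ρ H v := by
  have hmul : (H.relIndex (stabilizerIn ρ K v) : k) * ((stabilizerIn ρ K v).index : k) =
      (H.index : k) := by
    rw [← Nat.cast_mul, Subgroup.relIndex_mul_index hH]
  have h1 : (H.relIndex (stabilizerIn ρ K v) : k) ≠ 0 := fun h0 => hk (by rw [← hmul, h0, zero_mul])
  rw [cosetSum_eq_of_le hH le_rfl, ← Nat.cast_smul_eq_nsmul k, smul_smul]
  unfold levelAverage
  congr 1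
  rw [← hmul, mul_inv, mul_right_comm, inv_mul_cancel₀ h1, one_mul]

/-- `e_K` is additive (on vectors with finite-index stabilisers, in characteristic `0`). -/
theorem levelAverage_add [CharZero k] {K : Subgroup G} {v w : V}
    [(stabilizerIn ρ K v).FiniteIndex] [(stabilizerIn ρ K w).FiniteIndex] :
    levelAverage ρ K (v + w) = levelAverage ρ K v + levelAverage ρ K w := by
  have hk : ((stabilizerIn ρ K v ⊓ stabilizerIn ρ K w).index : k) ≠ 0 :=
    Nat.cast_ne_zero.2 Subgroup.FiniteIndex.index_ne_zero
  rw [levelAverage_eq (inf_le_stabilizerIn_add K v w) hk, levelAverage_eq inf_le_left hk,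
    levelAverage_eq inf_le_right hk, ← smul_add]
  congr 1
  letI : Fintype (K ⧸ (stabilizerIn ρ K v ⊓ stabilizerIn ρ K w)) := Fintype.ofFinite _
  unfold cosetSum
  simp only [finsum_eq_sum_of_fintype, map_add, Finset.sum_add_distrib]

/-- `e_K` commutes with scalars. -/
theorem levelAverage_smul {K : Subgroup G} {v : V} [(stabilizerIn ρ K v).FiniteIndex]
    (hk : ((stabilizerIn ρ K v).index : k) ≠ 0) (c : k) :
    levelAverage ρ K (c • v) = c • levelAverage ρ K v := by
  rw [levelAverage_eq (stabilizerIn_le_smul K c v) hk]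
  unfold levelAverage
  rw [smul_comm]
  congr 1
  letI : Fintype (K ⧸ stabilizerIn ρ K v) := Fintype.ofFinite _
  unfold cosetSum
  rw [finsum_eq_sum_of_fintype, finsum_eq_sum_of_fintype, Finset.smul_sum]
  exact Finset.sum_congr rfl (fun _ _ => LinearMap.map_smul _ _ _)

/-- `K`-finiteness of `ρ`: every stabiliser in `K` has finite index (automatic for a smooth `ρ`
and a compact `K`, `kFinite_of_isSmooth`). -/
def KFinite (ρ : Representation k G V) (K : Subgroup G) : Prop :=
  ∀ v : V, (stabilizerIn ρ K v).FiniteIndex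

/-- The level idempotent `e_K` as a `k`-linear endomorphism of `V`. -/
noncomputable def levelIdempotent [CharZero k] (K : Subgroup G) (h : KFinite ρ K) : V →ₗ[k] V where
  toFun := levelAverage ρ K
  map_add' v w := by
    haveI := h v
    haveI := h w
    exact levelAverage_add
  map_smul' c v := by
    haveI := h v
    exact levelAverage_smul (Nat.cast_ne_zero.2 Subgroup.FiniteIndex.index_ne_zero) c

/-- `levelIdempotent` applied to a vector. -/
@[simp] theorem levelIdempotent_apply [CharZero k] (K : Subgroup G) (h : KFinite ρ K) (v : V) :
    levelIdempotent (ρ := ρ) K h v = levelAverage ρ K v := rfl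

end Average

section Projector

variable {ρ : Representation k G V}

/-- `ρ κ₀ ∘ e_K = e_K` for `κ₀ ∈ K`. -/
theorem apply_levelAverage {K : Subgroup G} {v : V} [(stabilizerIn ρ K v).FiniteIndex] (κ₀ : K) :
    ρ (κ₀ : G) (levelAverage ρ K v) = levelAverage ρ K v := by
  unfold levelAverage
  rw [map_smul, apply_cosetSum le_rfl]

/-- The image of `e_K` lies in the `K`-invariants. -/
theorem levelAverage_mem_invariants {K : Subgroup G} {v : V} [(stabilizerIn ρ K v).FiniteIndex] :
    levelAverage ρ K v ∈ invariants ρ K :=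
  mem_invariants_iff.2 fun g hg => apply_levelAverage (⟨g, hg⟩ : K)

/-- `e_K` is the identity on the `K`-invariants. -/
theorem levelAverage_of_mem_invariants {K : Subgroup G} {v : V} (hv : v ∈ invariants ρ K) :
    levelAverage ρ K v = v := by
  have hS : stabilizerIn ρ K v = ⊤ := stabilizerIn_eq_top_iff.2 hv
  unfold levelAverage
  rw [hS, Subgroup.index_top, Nat.cast_one, inv_one, one_smul, cosetSum_top hv]

/-- `e_K v = v` exactly when `v` is `K`-invariant: the dictionary `π^K = e_K π`. -/
theorem levelAverage_eq_self_iff {K : Subgroup G} {v : V} [(stabilizerIn ρ K v).FiniteIndex] :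
    levelAverage ρ K v = v ↔ v ∈ invariants ρ K :=
  ⟨fun h => h ▸ levelAverage_mem_invariants, levelAverage_of_mem_invariants⟩

/-- `e_K` is idempotent. -/
theorem levelAverage_levelAverage {K : Subgroup G} {v : V} [(stabilizerIn ρ K v).FiniteIndex] :
    levelAverage ρ K (levelAverage ρ K v) = levelAverage ρ K v :=
  levelAverage_of_mem_invariants levelAverage_mem_invariants

/-- `e_K ∘ ρ κ₀ = e_K` for `κ₀ ∈ K` (computed over the normal core of `K_v`, which fixes both
`v` and `ρ κ₀ v`; right translation permutes the cosets of a normal subgroup). -/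
theorem levelAverage_apply [CharZero k] {K : Subgroup G} {v : V} [(stabilizerIn ρ K v).FiniteIndex]
    (κ₀ : K) : levelAverage ρ K (ρ (κ₀ : G) v) = levelAverage ρ K v := by
  haveI hN : (stabilizerIn ρ K v).normalCore.Normal := Subgroup.normalCore_normal _
  haveI : (stabilizerIn ρ K v).normalCore.FiniteIndex := Subgroup.finiteIndex_normalCore _
  have hk : ((stabilizerIn ρ K v).normalCore.index : k) ≠ 0 :=
    Nat.cast_ne_zero.2 Subgroup.FiniteIndex.index_ne_zero
  rw [levelAverage_eq (normalCore_le_stabilizerIn_apply κ₀ v) hk,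
    levelAverage_eq (Subgroup.normalCore_le _) hk]
  congr 1
  letI : Fintype (K ⧸ (stabilizerIn ρ K v).normalCore) := Fintype.ofFinite _
  unfold cosetSum
  rw [finsum_eq_sum_of_fintype, finsum_eq_sum_of_fintype]
  refine Fintype.sum_equiv (Equiv.mulRight ((κ₀ : K) : K ⧸ (stabilizerIn ρ K v).normalCore)) _ _
    (fun c => ?_)
  obtain ⟨κ, rfl⟩ := QuotientGroup.mk_surjective c
  show ρ ((Quotient.out (κ : K ⧸ (stabilizerIn ρ K v).normalCore) : K) : G) (ρ (κ₀ : G) v) =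
    ρ ((Quotient.out ((κ : K ⧸ (stabilizerIn ρ K v).normalCore) *
      (κ₀ : K ⧸ (stabilizerIn ρ K v).normalCore)) : K) : G) v
  rw [← QuotientGroup.mk_mul, rep_eq (normalCore_le_stabilizerIn_apply κ₀ v) κ,
    rep_eq (Subgroup.normalCore_le _) (κ * κ₀), Subgroup.coe_mul, map_mul, Module.End.mul_apply]

/-- For `K' ≤ K`: `e_{K'} ∘ e_K = e_K`. -/
theorem levelAverage_levelAverage_of_le {K' K : Subgroup G} (hle : K' ≤ K) {v : V}
    [(stabilizerIn ρ K v).FiniteIndex] :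
    levelAverage ρ K' (levelAverage ρ K v) = levelAverage ρ K v :=
  levelAverage_of_mem_invariants (invariants_mono hle levelAverage_mem_invariants)

/-- The linear map `e_K` sends a coset sum over any finite-index `H ≤ K'`, `K' ≤ K`, to `[K' : H] • e_K v`
(each translate `ρ κ v`, `κ ∈ K`, has the same `e_K`-average as `v`). -/
theorem levelIdempotent_cosetSum [CharZero k] {K' K : Subgroup G} (hle : K' ≤ K) (hK : KFinite ρ K)
    {H : Subgroup K'} {v : V} [H.FiniteIndex] :
    levelIdempotent K hK (cosetSum ρ H v) = H.index • levelAverage ρ K v := by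
  letI : Fintype (K' ⧸ H) := Fintype.ofFinite _
  unfold cosetSum
  rw [finsum_eq_sum_of_fintype, map_sum]
  have hterm : ∀ c : K' ⧸ H,
      levelIdempotent K hK (ρ ((Quotient.out c : K') : G) v) = levelAverage ρ K v := by
    intro c
    haveI := hK v
    rw [levelIdempotent_apply]
    exact levelAverage_apply (ρ := ρ) (⟨((Quotient.out c : K') : G), hle (Quotient.out c).2⟩ : K)
  simp only [hterm, Finset.sum_const, Finset.card_univ]
  rw [Subgroup.index_eq_card, Nat.card_eq_fintype_card]

/-- For `K' ≤ K`: `e_K ∘ e_{K'} = e_K`. -/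
theorem levelAverage_of_le [CharZero k] {K' K : Subgroup G} (hle : K' ≤ K) (hK : KFinite ρ K)
    {v : V} [(stabilizerIn ρ K' v).FiniteIndex] :
    levelAverage ρ K (levelAverage ρ K' v) = levelAverage ρ K v := by
  have hk : ((stabilizerIn ρ K' v).index : k) ≠ 0 :=
    Nat.cast_ne_zero.2 Subgroup.FiniteIndex.index_ne_zero
  calc levelAverage ρ K (levelAverage ρ K' v)
      = levelIdempotent K hK (((stabilizerIn ρ K' v).index : k)⁻¹ •
          cosetSum ρ (stabilizerIn ρ K' v) v) := rfl
    _ = ((stabilizerIn ρ K' v).index : k)⁻¹ • ((stabilizerIn ρ K' v).index • levelAverage ρ K v) := by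
        rw [map_smul, levelIdempotent_cosetSum hle hK]
    _ = levelAverage ρ K v := by
        rw [← Nat.cast_smul_eq_nsmul k, smul_smul, inv_mul_cancel₀ hk, one_smul]

variable (ρ)

/-- `e_K` is a projector onto the `K`-invariants. -/
theorem isProj_levelIdempotent [CharZero k] (K : Subgroup G) (h : KFinite ρ K) :
    LinearMap.IsProj (invariants ρ K) (levelIdempotent K h) where
  map_mem v := by
    haveI := h v
    exact levelAverage_mem_invariants
  map_id v hv := levelAverage_of_mem_invariants hv

/-- The range of `e_K` is exactly `V^K`: «`e_K • π = π^K`». -/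
theorem range_levelIdempotent [CharZero k] (K : Subgroup G) (h : KFinite ρ K) :
    LinearMap.range (levelIdempotent K h) = invariants ρ K := by
  apply le_antisymm
  · rintro _ ⟨v, rfl⟩
    haveI := h v
    exact levelAverage_mem_invariants
  · intro v hv
    exact ⟨v, levelAverage_of_mem_invariants hv⟩

/-- `e_K` is an idempotent of `End_k(V)`. -/
theorem isIdempotentElem_levelIdempotent [CharZero k] (K : Subgroup G) (h : KFinite ρ K) :
    IsIdempotentElem (levelIdempotent (ρ := ρ) K h) := by
  refine LinearMap.ext fun v => ?_
  rw [Module.End.mul_apply, levelIdempotent_apply, levelIdempotent_apply]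
  haveI := h v
  exact levelAverage_levelAverage

/-- For `K' ≤ K`: `e_{K'} e_K = e_K` in `End_k(V)`. -/
theorem levelIdempotent_mul_of_le [CharZero k] {K' K : Subgroup G} (hle : K' ≤ K)
    (hK' : KFinite ρ K') (hK : KFinite ρ K) :
    levelIdempotent (ρ := ρ) K' hK' * levelIdempotent (ρ := ρ) K hK = levelIdempotent (ρ := ρ) K hK := by
  refine LinearMap.ext fun v => ?_
  simp only [Module.End.mul_apply, levelIdempotent_apply]
  haveI := hK v
  exact levelAverage_levelAverage_of_le hle

/-- For `K' ≤ K`: `e_K e_{K'} = e_K` in `End_k(V)`. -/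
theorem mul_levelIdempotent_of_le [CharZero k] {K' K : Subgroup G} (hle : K' ≤ K)
    (hK' : KFinite ρ K') (hK : KFinite ρ K) :
    levelIdempotent (ρ := ρ) K hK * levelIdempotent (ρ := ρ) K' hK' = levelIdempotent (ρ := ρ) K hK := by
  refine LinearMap.ext fun v => ?_
  simp only [Module.End.mul_apply, levelIdempotent_apply]
  haveI := hK' v
  exact levelAverage_of_le hle hK

end Projector

section Smooth

variable {ρ : Representation k G V} [TopologicalSpace G] [IsTopologicalGroup G]

omit [IsTopologicalGroup G] in
/-- For a smooth `ρ`, the stabiliser of `v` in `K` is open in `K`. -/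
theorem isOpen_stabilizerIn (hρ : IsSmooth ρ) (K : Subgroup G) (v : V) :
    IsOpen ((stabilizerIn ρ K v : Subgroup K) : Set K) := by
  have h : IsOpen ((stabilizer ρ v : Subgroup G) : Set G) := hρ v
  rw [stabilizerIn, Subgroup.coe_subgroupOf]
  exact h.preimage continuous_subtype_val

/-- Smooth `ρ`, compact `K`: every stabiliser in `K` has finite index (an open subgroup of a
compact group has finite index). -/
theorem finiteIndex_stabilizerIn_of_isSmooth (hρ : IsSmooth ρ) {K : Subgroup G}
    (hK : IsCompact (K : Set G)) (v : V) : (stabilizerIn ρ K v).FiniteIndex := by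
  haveI : CompactSpace K := isCompact_iff_compactSpace.mp hK
  haveI : Finite (K ⧸ stabilizerIn ρ K v) :=
    Subgroup.quotient_finite_of_isOpen _ (isOpen_stabilizerIn hρ K v)
  exact Subgroup.finiteIndex_of_finite_quotient

/-- Smooth `ρ`, compact `K` ⇒ `K`-finite. -/
theorem kFinite_of_isSmooth (hρ : IsSmooth ρ) {K : Subgroup G} (hK : IsCompact (K : Set G)) :
    KFinite ρ K :=
  fun v => finiteIndex_stabilizerIn_of_isSmooth hρ hK v

/-- The dictionary for a smooth representation and a compact subgroup in characteristic `0`: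
`e_K` is a linear projector with range `V^K`. -/
theorem range_levelIdempotent_of_isSmooth [CharZero k] (hρ : IsSmooth ρ) {K : Subgroup G}
    (hK : IsCompact (K : Set G)) :
    LinearMap.range (levelIdempotent K (kFinite_of_isSmooth hρ hK)) = invariants ρ K :=
  range_levelIdempotent ρ K _

end Smooth

end Summit.Ventures.HodgeRepro2.T5LevelIdempotent
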